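import Literature.NumberTheory.ComplexMultiplication.ReflexNormInducedType
import Literature.NumberTheory.ComplexMultiplication.ComplexReflexField
import Literature.NumberTheory.Automorphic.IdeleClassCharacterValueFieldCM
import Literature.AlgebraicGeometry.Motives.AbelianVarietyCotangent
import HarnessLib

/-!
# [Liu 2021] Definition 4.5 AS PRINTED — the reciprocity map `η'_μ`, `η_μ`, and the CM data `D_μ = (A_μ, i_μ, λ_μ, r_μ)`

Y. Liu, *Fourier–Jacobi cycles and arithmetic relative trace formula*, Camb. J. Math. **9** (2021) 1–147 =
arXiv:2102.11518 [Liu2021]; TeX source `FJcycle.tex` (md5 `6db49a74122d…`), §4.1, Definition 4.5 = TeX label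
`de:cm_data`, ll. 1936–1964.  Sub-object (I1) of the cells' `hCMisogE` table (pub-hodgecm2 `HOME/pinning/HCMISOG-TABLE.md`);
companion of `Thm418AsPrinted` (Thm. 4.18 keeps the objects of `𝒜(μ)` as the ⟨CARRIER⟩ `Thm418Data.Obj`), of lit-liu-1's
`Prop46AsPrinted` (Prop. 4.6 (1): `𝒜(μ)` non-empty) and of tr-prover-1's `ReflexNormInducedType` (sub-object (N)).

AS PRINTED (ll. 1936–1964), VERBATIM:
«**Definition 4.5.** Let `μ` be a conjugate symplectic automorphic character of weight one.  [l. 1937]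
 (1) We denote by `η'_μ : Res_{M'_μ/ℚ} 𝔾_m → Res_{E/ℚ} 𝔾_m` the reciprocity map, and put  [l. 1939]
     `η_μ := η'_μ ∘ Nm_{M_μ/M'_μ} : Res_{M_μ/ℚ} 𝔾_m → Res_{E/ℚ} 𝔾_m`.  [l. 1941]
 (2) We define a *CM data for `μ`* to be a quadruple `D_μ = (A_μ, i_μ, λ_μ, r_μ)`, in which  [l. 1944]
     • `A_μ` is an abelian variety over `E`,  [l. 1946]
     • `i_μ : M_μ → End_E(A_μ)_ℚ` is a CM structure such that  [l. 1948]
        – for every `x ∈ M_μ`, the determinant of the action of `i_μ(x)` on the `E`-vector space `Lie_E(A_μ)` equals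
          `η_μ(x)`,  [l. 1950]
        – the associated CM character of `A_μ` with respect to the inclusion `M_μ ↪ ℂ` coincides with `μ^{alg}`,  [l. 1952]
     • `λ_μ : A_μ → A_μ^∨` is a polarization satisfying `λ ∘ i_μ(x) = i_μ(x̄)^∨ ∘ λ` for every `x ∈ M_μ`,  [l. 1955]
     • `r_μ : M_μ ⊗_ℚ E → H_1^{dR}(A_μ/E)` is an isomorphism of `M_μ ⊗_ℚ E`-modules satisfying that there exist an element
       `β ∈ M_μ` and an isomorphism `c : H^{dR}_{2 dim A_μ}(A_μ/E) → E` of `E`-modules, such that for every `x, y ∈ M_μ ⊗_ℚ E`,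
       we have `c(⟨r_μ(x), r_μ(y)⟩_λ) = Tr_{M_μ ⊗_ℚ E/E}(x β ȳ)`, where `⟨ , ⟩_λ` denotes the pairing induced by `λ`.  [l. 1957]
 (3) We denote by `𝒜(μ)` the *category of CM data for `μ`*, whose objects are CM data `D_μ`, and morphisms […] are
     isogenies `φ : A_μ → A'_μ` satisfying `φ ∘ i_μ(x) = i'_μ(x) ∘ φ` for every `x ∈ M_μ`, `φ^∨ ∘ λ'_μ ∘ φ = c λ_μ` for some
     element `c ∈ ℚ^×`, and `r'_μ = φ_* ∘ r_μ`.  [l. 1960]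
 (4) From a CM data `D_μ` for `μ`, we define another quadruple `D_μ^∨ = (A_μ^∨, i_μ^∨, λ_μ^∨, r_μ^∨)` […].  [l. 1962]»
Context (§4.1): «`M'_μ ⊆ ℂ` the reflex field of `(E, Φ_μ)`, with the induced CM type `Ψ_μ`» (Def. 4.3 (2), l. 1919);
«`M_μ ⊆ ℂ` the subfield generated by values `μ^{alg}(x)` for `x ∈ (𝔸_E^∞)^×`, which is a number field containing `M'_μ`»
(l. 1928).

## The typing (paper order).  REAL = a tree object; DEFINED = defined here from tree objects; ⟨CARRIER⟩ = posited datum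

* `E` — Liu's CM field `E` (`[NumberField E] [IsCMField E]`); `μ : IdeleClassGroup E →ₜ* Circle` with
  `hμ : IsConjugateSymplectic E μ` (Def. 4.1) — REAL, as in `Thm418Data`; «of weight one» (l. 1937) = `HasWeight E μ 1`,
  a parameter of `CMDatum` (not used by the other definitions, which make sense for any conjugate symplectic `μ`);
  `Φ_μ = hμ.cmType` (Def. 4.3 (2)); `M_μ = IdeleClassGroup.muAlgValueField E μ ⊆ ℂ` — REAL (l. 1928; a CM number field:
  `IsConjugateSymplectic.numberField_muAlgValueField`, `…isCMField_muAlgValueField`; `= (Liu2021.fieldOfValues E μ).toSubfield`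
  by `Liu2021.fieldOfValues_toSubfield`).
* PRESENTATION OF `M'_μ`.  In print `M'_μ ⊆ ℂ`; the tree's reflex-field theory (`…ComplexMultiplication.ReflexType`,
  `ReflexCMType`, `ReflexNorm`, Shimura 1998 §8) reads the complex CM type `Φ_μ` inside a CM field `L` Galois over `ℚ`
  receiving `E` along `φ : E →ₐ[ℚ] L`, through `ι : L →+* ℂ`: `M'_μ` is PRESENTED as the subfield
  `K*_μ := reflexField ℚ L (algValuedIn ι Φ_μ) ⊆ L`, with `ι(K*_μ) = M'_μ` (`map_reflexField_algValuedIn`: `ι(K*_μ)` is the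
  field generated by the type traces, i.e. the reflex field of `(E, Φ_μ)` in `ℂ`), and `Ψ_μ` as `reflexCMType ι Φ_μ φ`.
  For a CM field Galois over `ℚ` (the cells' use) take `L = E`, `φ = AlgHom.id ℚ E`, `ι = ι₁` any complex embedding.
  READING I1-R1: the presentation `(L, φ, ι)` is bookkeeping for `M'_μ ⊆ ℂ`; Liu's `η'_μ`, `η_μ`, `𝒜(μ)` do not depend
  on it (the reciprocity map is a morphism of `ℚ`-tori); this file does not prove the independence and every definition
  carries `(φ, ι)` explicitly.
* «containing `M'_μ`» (l. 1928): `Def45.incl φ ι hμ : K*_μ →+* M_μ`, `(incl k : ℂ) = ι k` — DEFINED (the inclusion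
  `M'_μ ⊆ M_μ`; tree `IsConjugateSymplectic.traceField_le_muAlgValueField`), unique with this property (`eq_incl`).
* (1) «`η'_μ` … the reciprocity map» (l. 1939) — DEFINED: `Def45.etaPrime φ ι hμ : K*_μ →* E` IS Shimura's reflex norm
  `g(a) = ∏ⱼ a^{ψⱼ}` of the CM type `(E, Φ_μ)` valued in `E` ([Shimura1998] §8.3 Prop. 29, §18.5 (18.5b); tree
  `reflexNormHom`), the reciprocity map of the theory of complex multiplication on `ℚ`-points; READING I1-R2: «the
  reciprocity map `Res_{M'_μ/ℚ}𝔾_m → Res_{E/ℚ}𝔾_m`» = the type norm `N_{Ψ_μ}` of the reflex type (as in [Den89] §2, which §4.1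
  generalises, l. 1897).  This is the reading the paper itself uses: the proof of Prop. 4.6 (1) (ll. 1975–1982) produces
  `(A', i')` by «Casselman's theorem [Shi71, Theorem 6]» for `(K, Φ) = (M'_μ, Ψ_μ)`, `(K', Φ') = (E, Φ_μ)`, with «the determinant
  of the action of `i'(x')` on the `E'`-vector space `Lie_{E'}(A')` is `η'_μ(x')` for every `x' ∈ M'_μ`» (l. 1979) — for an
  abelian variety of CM type `(M'_μ, Ψ_μ)` that determinant is the type norm `∏_{ψ ∈ Ψ_μ} ψ(x')`, valued in the reflex field `E`
  of `(M'_μ, Ψ_μ)`.  Weight check: on `x ∈ ℚ^× ⊆ M_μ`, `η_μ(x) = x^{[M_μ:M'_μ]·|Ψ_μ|} = x^{[M_μ:ℚ]/2} = x^{dim A_μ} = det(x | Lie_E A_μ)`,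
  consistent with the first bullet (the inverse convention is not).  «`η_μ := η'_μ ∘ Nm_{M_μ/M'_μ}`» (l. 1941) — DEFINED:
  `Def45.eta φ ι hμ : M_μ →* E`, the norm taken along `incl`.  PROVED (tr-prover-1's (N), `ReflexNormInducedType`):
  `ι(φ(η_μ(x))) = ∏_{θ ∈ Ψ̃_μ} θ(x)` with `Ψ̃_μ = inducedCMType incl (reflexCMType ι Φ_μ φ)` the CM type of `M_μ` induced from
  `Ψ_μ` (`Def45.apply_eta_eq_finprod`).
* (2) `Def45.CMDatum φ ι hμ hw C` — the quadruples, fields in print order: `A : AbelianVariety E` — REAL (l. 1946);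
  `i : M_μ →+* End⁰(A)` — REAL (`AbelianVariety.endAlgebra A = ℚ ⊗_ℤ End A`, l. 1948), with «is a CM structure» typed as
  `[M_μ : ℚ] = 2 dim A_μ` (READING I1-R3: a CM structure by the field `M_μ` on `A_μ` is an embedding of `M_μ`, a CM field —
  tree theorem — of degree `2 dim A_μ` into `End⁰(A_μ)`; a ring map out of a field is injective); FIRST BULLET `det45` (l. 1950)
  — REAL, on the COTANGENT SPACE at the origin (b11's `AbelianVariety.Cotangent A = 𝔪_e/𝔪_e²` with the contravariant action
  `AbelianVariety.cotangentMap A f = f^*`, (L1a)): `Lie_E(A_μ) = (𝔪_e/𝔪_e²)^∨`, the action of `f` on `Lie` is the transpose of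
  `f^*`, so the two determinants agree; an element `i_μ(x) ∈ End⁰(A)` is `M⁻¹ · (1 ⊗ f)` with `M ≥ 1`, `f ∈ End(A)` (tree
  `endAlgebra.exists_eq_algebraMap_mul_of`) and acts as `M⁻¹ f`, so «det of the action of `i_μ(x)` on `Lie_E(A_μ)` equals
  `η_μ(x)`» reads `det(f^* | 𝔪_e/𝔪_e²) = M^{dim A_μ} · η_μ(x)` for EVERY such presentation (READING I1-R4; `dim_E Lie_E(A_μ) =
  dim A_μ`, b11's `finrank_cotangent`); SECOND BULLET (l. 1952), `λ_μ` (l. 1955), `r_μ` (l. 1957) — ⟨CARRIER⟩: the tree has no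
  CM character attached to an abelian variety over a number field, no dual abelian variety / polarisation over `E`, no
  algebraic de Rham homology; they are posited through `Def45.Carriers` (a predicate for the second bullet, a type of pairs
  `(λ_μ, r_μ)` for the last two bullets) and are NOT consumed by any cell theorem (`hCMisogE` uses `A`, `i`, `finrank_eq`,
  `det45` only).  INTEGRALITY (cells' decision (α)): `i_μ` is RATIONAL as printed — no `𝓞_{M_μ}`-stability field.
* (3)–(4): the morphisms of `𝒜(μ)` and the dual datum are not typed here (Thm. 4.18 sees `𝒜(μ)` through its objects and the
  ⟨CARRIER⟩ `Ω(μ)`; Prop. 4.6 (1) is lit-liu-1's `Prop46AsPrinted`).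
UNIVERSE NOTE for the glue: `CMDatum … : Type 1` (it holds a scheme), while `Thm418Data.Obj : Type`; an instantiation
`Obj := CMDatum …` needs a small index of objects (or a universe bump of `Obj`) — the glue's choice, not made here.

Nothing is asserted: two ring/monoid homomorphisms are DEFINED from tree objects, one identity is PROVED, and the
structure `CMDatum` is a hypothesis carrier whose inhabitation for every weight-one `μ` is [Liu2021] Prop. 4.6 (1).

## References
* [Liu2021] Y. Liu, Camb. J. Math. 9 (2021) 1–147 = arXiv:2102.11518 — Def. 4.3 (2) (l. 1919), §4.1 l. 1928, Def. 4.5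
  (ll. 1936–1964), Prop. 4.6 (1) (l. 1969).
* [Shimura1998] G. Shimura, *Abelian Varieties with Complex Multiplication and Modular Functions*, Princeton 1998, §8.3
  Prop. 28–29, §18.5 (18.5b).
* [Den89] C. Deninger, *Higher regulators and Hecke `L`-series of imaginary quadratic fields. I*, Invent. Math. 96 (1989)
  1–69 — §2, as cited by [Liu2021] §4.1 l. 1897 (`\cite{Den89}*{Section~2}`) and in the proof of Prop. 4.6 (1), l. 1982 («(2.1)»).
* [Shi71] G. Shimura, *On the zeta-function of an abelian variety with complex multiplication*, Ann. of Math. 94 (1971)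
  504–533 — Thm. 6 (Casselman's theorem), as cited in the proof of [Liu2021] Prop. 4.6 (1), l. 1977.
-/

set_option autoImplicit false

noncomputable section

open NumberField
open Literature.AlgebraicGeometry.Motives (CMType AbelianVariety)
open Literature.NumberTheory.ComplexMultiplication

namespace Literature.NumberTheory.Automorphic.Liu2021

namespace Def45

variable {E : Type} [Field E] [NumberField E] [IsCMField E]
variable {L : Type} [Field L] [NumberField L] [IsGalois ℚ L] (φ : E →ₐ[ℚ] L) (ι : L →+* ℂ)
variable {μ : IdeleClassGroup E →ₜ* Circle} (hμ : IdeleClassGroup.IsConjugateSymplectic E μ)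

/-! ## «`M_μ` … a number field containing `M'_μ`» (l. 1928): the inclusion `M'_μ ⊆ M_μ` in the presentation `(L, φ, ι)` -/

/-- `ι(K*_μ) ⊆ M_μ`: the presented reflex field `K*_μ = reflexField ℚ L (algValuedIn ι Φ_μ)` is carried by `ι` onto
`M'_μ = ℚ(tr_{Φ_μ}(E))` (`map_reflexField_algValuedIn`), and «`M_μ` … containing `M'_μ`» (tree
`IsConjugateSymplectic.traceField_le_muAlgValueField`). [cite: Liu2021, §4.1 l. 1928 and Def. 4.3 (2) (l. 1919)] -/
theorem apply_mem_muAlgValueField (j : E →ₐ[ℚ] L) (k : reflexField ℚ L (algValuedIn ι hμ.cmType.1)) :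
    ι k ∈ IdeleClassGroup.muAlgValueField E μ := by
  have hk : ι k ∈ traceField hμ.cmType := by
    rw [← map_reflexField_algValuedIn j ι hμ.cmType, IntermediateField.mem_map]
    exact ⟨k, k.2, rfl⟩
  exact hμ.traceField_le_muAlgValueField hμ.hasCMType_cmType hk

/-- **The inclusion `M'_μ ⊆ M_μ`** (l. 1928) in the presentation `(L, φ, ι)`: `K*_μ → M_μ`, `k ↦ ι(k)`.  DEFINED.
[cite: Liu2021, §4.1 l. 1928] -/
def incl : reflexField ℚ L (algValuedIn ι hμ.cmType.1) →+* IdeleClassGroup.muAlgValueField E μ :=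
  (ι.comp (reflexField ℚ L (algValuedIn ι hμ.cmType.1)).val.toRingHom).codRestrict
    (IdeleClassGroup.muAlgValueField E μ) (apply_mem_muAlgValueField ι hμ φ)

/-- `incl k`, as a complex number, is `ι k`. [cite: Liu2021, §4.1 l. 1928] -/
@[simp] theorem coe_incl (k : reflexField ℚ L (algValuedIn ι hμ.cmType.1)) :
    ((incl φ ι hμ k : IdeleClassGroup.muAlgValueField E μ) : ℂ) = ι k := rfl

/-- The inclusion is THE ring map `K*_μ → M_μ` over `ℂ`: any `e` with `(e k : ℂ) = ι k` is `incl` (this is the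
quantified form `∀ e, (∀ k, (e k : ℂ) = ι₁ k) → …` used by the cells' binder `hCMisogE`). [cite: Liu2021, §4.1 l. 1928] -/
theorem eq_incl (e : reflexField ℚ L (algValuedIn ι hμ.cmType.1) →+* IdeleClassGroup.muAlgValueField E μ)
    (he : ∀ k, ((e k : IdeleClassGroup.muAlgValueField E μ) : ℂ) = ι k) : e = incl φ ι hμ :=
  RingHom.ext fun k => Subtype.ext (he k)

/-! ## Definition 4.5 (1): `η'_μ` and `η_μ` (ll. 1939–1942), DEFINED -/

/-- **[Liu2021, Def. 4.5 (1)] «We denote by `η'_μ : Res_{M'_μ/ℚ} 𝔾_m → Res_{E/ℚ} 𝔾_m` the reciprocity map»** (l. 1939), on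
`ℚ`-points and in the presentation `(L, φ, ι)` of `M'_μ`: DEFINED as Shimura's reflex norm `g : K*_μ → E`,
`φ(g(a)) = ∏_{ψ ∈ Φ_μ*} ψ(a)` (tree `reflexNormHom ℚ L (algValuedIn ι Φ_μ) φ`; `ι(φ(η'_μ(a))) = ∏_{τ ∈ Ψ_μ} τ(a)`,
`comp_reflexNormHom_eq_finprod`).  READING I1-R2 (module docstring). [cite: Liu2021, Def. 4.5 (1) (l. 1939)]
[cite: Shimura1998, §18.5 (18.5b)] -/
def etaPrime : reflexField ℚ L (algValuedIn ι hμ.cmType.1) →* E :=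
  reflexNormHom ℚ L (algValuedIn ι hμ.cmType.1) φ

/-- `η'_μ` is the tree's reflex norm (unfolding). [cite: Liu2021, Def. 4.5 (1) (l. 1939)] -/
theorem etaPrime_apply (a : reflexField ℚ L (algValuedIn ι hμ.cmType.1)) :
    etaPrime φ ι hμ a = reflexNormHom ℚ L (algValuedIn ι hμ.cmType.1) φ a := rfl

section ReadInC

variable [IsCMField L]

/-- `η'_μ` read in `ℂ`: `ι(φ(η'_μ(a))) = ∏_{τ ∈ Ψ_μ} τ(a)`, `Ψ_μ = reflexCMType ι Φ_μ φ` the reflex CM type of `M'_μ`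
(Def. 4.3 (2) «with the induced CM type `Ψ_μ`»; the tree's complex reflex type needs the CM involution of `L`).
[cite: Liu2021, Def. 4.3 (2) (l. 1919) and Def. 4.5 (1) (l. 1939)] [cite: Shimura1998, §8.3 Prop. 29] -/
theorem apply_etaPrime_eq_finprod (a : reflexField ℚ L (algValuedIn ι hμ.cmType.1)) :
    ι (φ (etaPrime φ ι hμ a)) = ∏ᶠ τ ∈ (reflexCMType ι hμ.cmType φ).1, τ a :=
  comp_reflexNormHom_eq_finprod ι hμ.cmType φ a

end ReadInC

/-- **[Liu2021, Def. 4.5 (1)] «`η_μ := η'_μ ∘ Nm_{M_μ/M'_μ} : Res_{M_μ/ℚ} 𝔾_m → Res_{E/ℚ} 𝔾_m`»** (l. 1941), on `ℚ`-points: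
`M_μ →* E`, the relative norm `Nm_{M_μ/M'_μ}` being taken along the inclusion `incl : K*_μ → M_μ`.  DEFINED.
[cite: Liu2021, Def. 4.5 (1) (l. 1941)] -/
def eta : IdeleClassGroup.muAlgValueField E μ →* E :=
  letI := (incl φ ι hμ).toAlgebra
  (etaPrime φ ι hμ).comp (Algebra.norm (reflexField ℚ L (algValuedIn ι hμ.cmType.1)))

/-- Unfolding of `η_μ`: `η_μ(x) = η'_μ(Nm_{M_μ/M'_μ}(x))`. [cite: Liu2021, Def. 4.5 (1) (l. 1941)] -/
theorem eta_apply (x : IdeleClassGroup.muAlgValueField E μ) :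
    eta φ ι hμ x =
      letI := (incl φ ι hμ).toAlgebra
      etaPrime φ ι hμ (Algebra.norm (reflexField ℚ L (algValuedIn ι hμ.cmType.1)) x) := rfl

section ReadInC2

variable [IsCMField L]

/-- **`η_μ` read in `ℂ` is the type norm of the induced type `Ψ̃_μ`** (sub-object (N), tr-prover-1's
`apply_reflexNormHom_norm_eq_finprod_inducedCMType_of_ringHom`): `ι(φ(η_μ(x))) = ∏_{θ ∈ Ψ̃_μ} θ(x)` for every
`x ∈ M_μ`, where `Ψ̃_μ = inducedCMType incl (reflexCMType ι Φ_μ φ) = {θ : M_μ → ℂ | θ|_{M'_μ} ∈ Ψ_μ}`.  This is the identity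
behind the first bullet of Def. 4.5 (2): a CM abelian variety of type `(M_μ, Ψ̃_μ)` has `det(x | Lie) = ∏_{θ ∈ Ψ̃_μ} θ(x)`.
[cite: Liu2021, Def. 4.5 (1) (l. 1941)] [cite: Shimura1998, §18.5 (18.5b)] -/
theorem apply_eta_eq_finprod (x : IdeleClassGroup.muAlgValueField E μ) :
    ι (φ (eta φ ι hμ x)) = ∏ᶠ θ ∈ (inducedCMType (incl φ ι hμ) (reflexCMType ι hμ.cmType φ)).1, θ x := by
  haveI := hμ.numberField_muAlgValueField
  exact apply_reflexNormHom_norm_eq_finprod_inducedCMType_of_ringHom ι hμ.cmType φ (incl φ ι hμ) x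

/-- The same with the inclusion quantified by its defining property (the shape of the cells' `hCMisogE`): for any
`e : K*_μ →+* M_μ` with `(e k : ℂ) = ι k`, `ι(φ(η_μ(x))) = ∏_{θ ∈ inducedCMType e Ψ_μ} θ(x)`.
[cite: Liu2021, Def. 4.5 (1) (l. 1941)] -/
theorem apply_eta_eq_finprod_of_coe_eq
    (e : reflexField ℚ L (algValuedIn ι hμ.cmType.1) →+* IdeleClassGroup.muAlgValueField E μ)
    (he : ∀ k, ((e k : IdeleClassGroup.muAlgValueField E μ) : ℂ) = ι k) (x : IdeleClassGroup.muAlgValueField E μ) :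
    ι (φ (eta φ ι hμ x)) = ∏ᶠ θ ∈ (inducedCMType e (reflexCMType ι hμ.cmType φ)).1, θ x := by
  rw [eq_incl φ ι hμ e he]
  exact apply_eta_eq_finprod φ ι hμ x

end ReadInC2

/-! ## Definition 4.5 (2): CM data `D_μ = (A_μ, i_μ, λ_μ, r_μ)` (ll. 1944–1958) -/

/-- **⟨CARRIER⟩s for the printed components of a CM datum that the tree cannot state** (module docstring, «The typing»):
* `IsCMCharacter A i` — the SECOND BULLET (l. 1952): «the associated CM character of `A_μ` with respect to the inclusion
  `M_μ ↪ ℂ` coincides with `μ^{alg}`» for the pair `(A_μ, i_μ) = (A, i)` (no CM character of an abelian variety over a number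
  field in the tree);
* `PolDR A i` — the DATA `(λ_μ, r_μ)` of the last two bullets for `(A, i)`: «`λ_μ : A_μ → A_μ^∨` is a polarization satisfying
  `λ ∘ i_μ(x) = i_μ(x̄)^∨ ∘ λ` for every `x ∈ M_μ`» (l. 1955) and «`r_μ : M_μ ⊗_ℚ E → H_1^{dR}(A_μ/E)` is an isomorphism of
  `M_μ ⊗_ℚ E`-modules satisfying that there exist an element `β ∈ M_μ` and an isomorphism `c : H^{dR}_{2 dim A_μ}(A_μ/E) → E` of
  `E`-modules, such that for every `x, y ∈ M_μ ⊗_ℚ E`, we have `c(⟨r_μ(x), r_μ(y)⟩_λ) = Tr_{M_μ ⊗_ℚ E/E}(x β ȳ)`» (l. 1957)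
  (no dual abelian variety, polarisation or algebraic de Rham homology over `E` in the tree).
Posited, never consumed by the cells' theorems. [cite: Liu2021, Def. 4.5 (2) (ll. 1952–1958)] -/
structure Carriers (E : Type) [Field E] [NumberField E] (μ : IdeleClassGroup E →ₜ* Circle) where
  /-- ⟨CARRIER⟩ second bullet (l. 1952): «the associated CM character of `A_μ` with respect to the inclusion `M_μ ↪ ℂ`
  coincides with `μ^{alg}`». -/
  IsCMCharacter : ∀ A : AbelianVariety E, (IdeleClassGroup.muAlgValueField E μ →+* A.endAlgebra) → Prop
  /-- ⟨CARRIER⟩ the pairs `(λ_μ, r_μ)` of the third and fourth bullets (ll. 1955–1958) over `(A_μ, i_μ)`. -/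
  PolDR : ∀ A : AbelianVariety E, (IdeleClassGroup.muAlgValueField E μ →+* A.endAlgebra) → Type

/-- **[Liu2021, Def. 4.5 (2)] «a *CM data for `μ`* … a quadruple `D_μ = (A_μ, i_μ, λ_μ, r_μ)`»** (l. 1944), for «`μ` a conjugate
symplectic automorphic character of weight one» (l. 1937: `hμ`, `hw`), in the presentation `(L, φ, ι)` of `M'_μ ⊆ ℂ` and over
the carriers `C`.  Fields in print order; `A`, `i`, `finrank_eq`, `det45` are REAL (the first bullet on the cotangent space
`𝔪_e/𝔪_e² = Lie_E(A_μ)^∨`, READING I1-R4), `isCMCharacter` and `polDR` are the ⟨CARRIER⟩ components.  `i_μ` is RATIONAL, as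
printed (no integrality condition).  An inhabitant for every weight-one `μ` is [Liu2021] Prop. 4.6 (1) (l. 1969), not asserted.
[cite: Liu2021, Def. 4.5 (2) (ll. 1944–1958)] -/
structure CMDatum (hw : IdeleClassGroup.HasWeight E μ 1) (C : Carriers E μ) : Type 1 where
  /-- «`A_μ` is an abelian variety over `E`» (l. 1946) — REAL. -/
  A : AbelianVariety E
  /-- «`i_μ : M_μ → End_E(A_μ)_ℚ`» (l. 1948) — REAL: a ring homomorphism into `End⁰(A_μ) = ℚ ⊗_ℤ End_E(A_μ)`
  (`AbelianVariety.endAlgebra`). -/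
  i : IdeleClassGroup.muAlgValueField E μ →+* A.endAlgebra
  /-- «is a CM structure» (l. 1948), READING I1-R3: `[M_μ : ℚ] = 2 dim A_μ`. -/
  finrank_eq : Module.finrank ℚ (IdeleClassGroup.muAlgValueField E μ) = 2 * A.dim
  /-- FIRST BULLET (l. 1950): «for every `x ∈ M_μ`, the determinant of the action of `i_μ(x)` on the `E`-vector space `Lie_E(A_μ)`
  equals `η_μ(x)`» — READING I1-R4: for every presentation `i_μ(x) = M⁻¹ · (1 ⊗ f)` (`M ≥ 1`, `f ∈ End_E(A_μ)`),
  `det(f^* | 𝔪_e/𝔪_e²) = M^{dim A_μ} · η_μ(x)` in `E`. -/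
  det45 : ∀ (x : IdeleClassGroup.muAlgValueField E μ) (M : ℕ) (f : CategoryTheory.End A), M ≠ 0 →
    i x = algebraMap ℚ A.endAlgebra (M : ℚ)⁻¹ * AbelianVariety.endAlgebra.of A f →
      LinearMap.det (AbelianVariety.cotangentMap A f) = (M : E) ^ A.dim * eta φ ι hμ x
  /-- ⟨CARRIER⟩ SECOND BULLET (l. 1952): the CM character of `(A_μ, i_μ)` is `μ^{alg}`. -/
  isCMCharacter : C.IsCMCharacter A i
  /-- ⟨CARRIER⟩ `(λ_μ, r_μ)` (ll. 1955–1958). -/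
  polDR : C.PolDR A i

namespace CMDatum

variable {φ ι hμ} {hw : IdeleClassGroup.HasWeight E μ 1} {C : Carriers E μ} (D : CMDatum φ ι hμ hw C)

/-- The first bullet at an INTEGRAL element: if `i_μ(x) = 1 ⊗ f` then `det(f^* | 𝔪_e/𝔪_e²) = η_μ(x)`.
[cite: Liu2021, Def. 4.5 (2) (l. 1950)] -/
theorem det_cotangentMap_eq_eta {x : IdeleClassGroup.muAlgValueField E μ} {f : CategoryTheory.End D.A}
    (h : D.i x = AbelianVariety.endAlgebra.of D.A f) :
    LinearMap.det (AbelianVariety.cotangentMap D.A f) = eta φ ι hμ x := by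
  have := D.det45 x 1 f one_ne_zero (by rw [h, Nat.cast_one, inv_one, map_one, one_mul])
  rwa [Nat.cast_one, one_pow, one_mul] at this

variable [IsCMField L] in
/-- The first bullet read in `ℂ` through `ι ∘ φ`: for `i_μ(x) = M⁻¹ · (1 ⊗ f)`,
`ι(φ(det(f^* | 𝔪_e/𝔪_e²))) = ι(φ(M))^{dim A_μ} · ∏_{θ ∈ Ψ̃_μ} θ(x)` — the product character of the induced type `Ψ̃_μ`, the
input of the CM-type identification of `A_μ ⊗_{E} ℂ` (sub-objects (L2)/(I2)). [cite: Liu2021, Def. 4.5 (2) (l. 1950)] -/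
theorem apply_det_cotangentMap_eq (x : IdeleClassGroup.muAlgValueField E μ) (M : ℕ) (f : CategoryTheory.End D.A)
    (hM : M ≠ 0) (h : D.i x = algebraMap ℚ D.A.endAlgebra (M : ℚ)⁻¹ * AbelianVariety.endAlgebra.of D.A f) :
    ι (φ (LinearMap.det (AbelianVariety.cotangentMap D.A f))) =
      (M : ℂ) ^ D.A.dim * ∏ᶠ θ ∈ (inducedCMType (incl φ ι hμ) (reflexCMType ι hμ.cmType φ)).1, θ x := by
  rw [D.det45 x M f hM h, map_mul, map_mul, map_pow, map_pow, map_natCast, map_natCast, apply_eta_eq_finprod]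

end CMDatum

end Def45

end Literature.NumberTheory.Automorphic.Liu2021

end
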